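import Literature.LinearAlgebra.Alternating.WedgeWords
import Mathlib.Algebra.Lie.Sl2
import Mathlib.Algebra.Lie.OfAssociative
import HarnessLib

/-!
# The Lefschetz `sl₂`-triple on alternating forms in CAR form, and pointwise hard Lefschetz

Pointwise linear algebra behind the hard Lefschetz theorem (C. Voisin, *Hodge Theory and Complex
Algebraic Geometry I* (2002), §6.2: Lemma 6.19 `[L, Λ] = (k - n) Id` on `k`-forms, Lemma 6.20
`Lⁿ⁻ᵏ : Ωᵏ_{X,x} → Ω²ⁿ⁻ᵏ_{X,x}` is an isomorphism; D. Huybrechts, *Complex Geometry* (2005),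
Prop. 1.2.26 and Prop. 1.2.30), in the CAR calculus of
`Literature/LinearAlgebra/Alternating/WedgeOne.lean` (`θ ∧ η = wedgeOne θ η`,
`w ⌟ η = η.curryLeft w`), for an abstract **split dual frame** of a normed space `E` over a
nontrivially normed field `𝕜`: covectors `θᵢ, θ'ᵢ : E →L[𝕜] 𝕜` and vectors `vᵢ, v'ᵢ` (`i ∈ ι`,
`|ι| = d`) with `θᵢ(vⱼ) = θ'ᵢ(v'ⱼ) = δᵢⱼ`, `θᵢ(v'ⱼ) = θ'ᵢ(vⱼ) = 0` and
`∑ᵢ (θᵢ ⊗ vᵢ + θ'ᵢ ⊗ v'ᵢ) = id` (for a Hermitian inner product with unitary frame `(eᵢ, Jeᵢ)`: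
`θᵢ = ⟪eᵢ, ·⟫`, `θ'ᵢ = ⟪Jeᵢ, ·⟫`, `vᵢ = eᵢ`, `v'ᵢ = Jeᵢ`, and then
`L η = ∑ᵢ θᵢ ∧ θ'ᵢ ∧ η = ω ∧ η` is the Lefschetz operator of the Kähler form
`ω = ∑ᵢ θᵢ ∧ θ'ᵢ`). Everything is written out (no new definitions); forms take values in any
normed `𝕜`-space `F`.

## Main statements (all proved)

* `curryLeft_curryLeft_wedgeOne_wedgeOne` (+ `_one`, `_zero`): the CAR bookkeeping
  `u' ⌟ u ⌟ (a ∧ a' ∧ η) = …` for covectors `a, a'` and vectors `u, u'` with `a(u') = a'(u) = 0`.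
* `lefschetz_comm_contract`: **Voisin's Lemma 6.19** `L(Λη) - Λ(Lη) = ((k+2) - d) η` on
  `(k+2)`-forms for `L η = ∑ᵢ θᵢ ∧ θ'ᵢ ∧ η`, `Λ η = ∑ᵢ v'ᵢ ⌟ vᵢ ⌟ η`, and the low degrees
  `contract_lefschetz_one` (`ΛL = (d - 1)` on `1`-forms), `contract_lefschetz_zero` (`ΛL = d` on
  `0`-forms), from the CAR identities and Euler's identity `∑ᵢ θᵢ ∧ vᵢ ⌟ = deg`
  (`sum_wedgeOne_curryLeft_two`).
* `sl2_eq_zero_of_pow_toEnd_e_eq_zero`: for a representation of an `sl₂`-triple `(h, e, f)`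
  (Mathlib's `IsSl2Triple`) on which `f` is locally nilpotent, `e^μ` is injective on the weight
  space `-μ` — from Mathlib's string lemma
  `IsSl2Triple.HasPrimitiveVectorWith.pow_toEnd_f_ne_zero_of_eq_nat` applied to the last vector
  of the `f`-string through `x`.
* `eq_zero_of_iterate_lefschetz_eq_zero`: **Voisin's Lemma 6.20, injectivity half**: if
  `k + j = d` then `Lʲ` is injective on `k`-forms (stated for the `L`-string `βᵢ₊₁ = L βᵢ`:
  `βⱼ = 0 → β₀ = 0`). Proof: `e = L`, `f = Λ`, `h = deg - d` form an `sl₂`-triple on the graded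
  module `Π_m Λᵐ` (built inside the proof), `Λ` lowers the degree, and the string lemma applies
  to `β₀`, of weight `k - d = -j`. (Bijectivity follows by dimension count where needed; the hard
  Lefschetz theorem only uses injectivity plus Poincaré duality.)

The identification of `L` with the wedge by the Kähler form of a Hermitian metric, and the
existence of unitary frames, are in `Literature/Geometry/Kaehler/` (pointwise layer of
`Literature.AlgebraicGeometry.Motives.hasHardLefschetzProperty_kaehlerClass`, hodge.S14).

## References

* C. Voisin, *Hodge Theory and Complex Algebraic Geometry I*, CUP (2002), §6.2.1, Lemma 6.19,
  Lemma 6.20; §6.2.3, Thm. 6.25. [Voisin2002]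
* D. Huybrechts, *Complex Geometry. An Introduction*, Springer (2005), Prop. 1.2.26, Cor. 1.2.28,
  Prop. 1.2.30. [Huybrechts2005]
* F. W. Warner, *Foundations of Differentiable Manifolds and Lie Groups* (1983), 2.10–2.11
  (interior multiplication and the CAR identities). [Warner1983]
-/

noncomputable section

open ContinuousAlternatingMap Function LieModule

namespace Literature.LinearAlgebra.Alternating

variable {𝕜 : Type*} [NontriviallyNormedField 𝕜] {E : Type*} [NormedAddCommGroup E]
  [NormedSpace 𝕜 E] {F : Type*} [NormedAddCommGroup F] [NormedSpace 𝕜 F] {n : ℕ}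

/-- `θ ∧ (-η) = -(θ ∧ η)`. [folklore] -/
theorem wedgeOne_neg (θ : E →L[𝕜] 𝕜) (η : E [⋀^Fin n]→L[𝕜] F) :
    wedgeOne θ (-η) = -wedgeOne θ η := by
  rw [← neg_one_smul 𝕜 η, wedgeOne_smul, neg_one_smul]

/-- `θ ∧ (η - η') = θ ∧ η - θ ∧ η'`. [folklore] -/
theorem wedgeOne_sub (θ : E →L[𝕜] 𝕜) (η η' : E [⋀^Fin n]→L[𝕜] F) :
    wedgeOne θ (η - η') = wedgeOne θ η - wedgeOne θ η' := by
  rw [sub_eq_add_neg, wedgeOne_add, wedgeOne_neg, ← sub_eq_add_neg]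

/-- `θ ∧ (∑ᵢ ηᵢ) = ∑ᵢ θ ∧ ηᵢ`. [folklore] -/
theorem wedgeOne_sum {ι : Type*} (s : Finset ι) (θ : E →L[𝕜] 𝕜) (η : ι → E [⋀^Fin n]→L[𝕜] F) :
    wedgeOne θ (∑ i ∈ s, η i) = ∑ i ∈ s, wedgeOne θ (η i) := by
  have := _root_.map_sum (wedgeOneL (𝕜' := 𝕜) θ) η s
  simpa only [wedgeOneL_apply] using this

/-- `w ⌟ (η + η') = w ⌟ η + w ⌟ η'`. [folklore] -/
theorem curryLeft_add_apply (η η' : E [⋀^Fin (n + 1)]→L[𝕜] F) (w : E) :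
    (η + η').curryLeft w = η.curryLeft w + η'.curryLeft w := by
  rw [curryLeft_add]; rfl

/-- `w ⌟ (η - η') = w ⌟ η - w ⌟ η'`. [folklore] -/
theorem curryLeft_sub_apply (η η' : E [⋀^Fin (n + 1)]→L[𝕜] F) (w : E) :
    (η - η').curryLeft w = η.curryLeft w - η'.curryLeft w := by
  have := _root_.map_sub (curryLeftL (𝕜' := 𝕜) (F := F) (n := n) w) η η'
  simpa only [curryLeftL_apply] using this

/-- `w ⌟ (∑ᵢ ηᵢ) = ∑ᵢ w ⌟ ηᵢ`. [folklore] -/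
theorem curryLeft_sum {ι : Type*} (s : Finset ι) (η : ι → E [⋀^Fin (n + 1)]→L[𝕜] F) (w : E) :
    (∑ i ∈ s, η i).curryLeft w = ∑ i ∈ s, (η i).curryLeft w := by
  have := _root_.map_sum (curryLeftL (𝕜' := 𝕜) (F := F) (n := n) w) η s
  simpa only [curryLeftL_apply] using this

/-- **Double contraction of a double wedge** (CAR bookkeeping for `[L, Λ]`). For covectors `a, a'`
and vectors `u, u'` with `a(u') = 0`, `a'(u) = 0`, and an `(n+2)`-form `η`:
`u' ⌟ u ⌟ (a ∧ a' ∧ η) = (a u · a' u') η - (a u) a' ∧ (u' ⌟ η) - (a' u') a ∧ (u ⌟ η)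
  + a ∧ a' ∧ (u' ⌟ u ⌟ η)`. [folklore] -/
theorem curryLeft_curryLeft_wedgeOne_wedgeOne (a a' : E →L[𝕜] 𝕜) (u u' : E) (hau : a u' = 0)
    (hau' : a' u = 0) (η : E [⋀^Fin (n + 2)]→L[𝕜] F) :
    ((wedgeOne a (wedgeOne a' η)).curryLeft u).curryLeft u' =
      (a u * a' u') • η - (a u) • wedgeOne a' (η.curryLeft u') -
        (a' u') • wedgeOne a (η.curryLeft u) +
          wedgeOne a (wedgeOne a' ((η.curryLeft u).curryLeft u')) := by
  rw [curryLeft_wedgeOne, curryLeft_wedgeOne, hau', zero_smul, zero_sub, wedgeOne_neg, sub_neg_eq_add,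
    curryLeft_add_apply, curryLeft_wedgeOne, curryLeft_wedgeOne, hau, zero_smul, zero_sub,
    curryLeft_smul', curryLeft_wedgeOne, wedgeOne_sub, wedgeOne_smul, smul_sub, mul_smul]
  abel

/-- The same in degree `1`: `u' ⌟ u ⌟ (a ∧ a' ∧ η) = (a u · a' u') η - (a u) a' ∧ (u' ⌟ η)
- (a' u') a ∧ (u ⌟ η)` for a `1`-form `η`. [folklore] -/
theorem curryLeft_curryLeft_wedgeOne_wedgeOne_one (a a' : E →L[𝕜] 𝕜) (u u' : E) (hau : a u' = 0)
    (hau' : a' u = 0) (η : E [⋀^Fin 1]→L[𝕜] F) :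
    ((wedgeOne a (wedgeOne a' η)).curryLeft u).curryLeft u' =
      (a u * a' u') • η - (a u) • wedgeOne a' (η.curryLeft u') -
        (a' u') • wedgeOne a (η.curryLeft u) := by
  rw [curryLeft_wedgeOne, curryLeft_wedgeOne, hau', zero_smul, zero_sub, wedgeOne_neg, sub_neg_eq_add,
    curryLeft_add_apply, curryLeft_wedgeOne, curryLeft_wedgeOne_zero, hau, zero_smul, zero_sub,
    curryLeft_smul', curryLeft_wedgeOne, wedgeOne_smul, smul_sub, mul_smul]
  abel

/-- The same in degree `0`: `u' ⌟ u ⌟ (a ∧ a' ∧ η) = (a u · a' u') η` for a `0`-form `η`.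
[folklore] -/
theorem curryLeft_curryLeft_wedgeOne_wedgeOne_zero (a a' : E →L[𝕜] 𝕜) (u u' : E)
    (hau' : a' u = 0) (η : E [⋀^Fin 0]→L[𝕜] F) :
    ((wedgeOne a (wedgeOne a' η)).curryLeft u).curryLeft u' = (a u * a' u') • η := by
  rw [curryLeft_wedgeOne, curryLeft_wedgeOne_zero, hau', zero_smul, wedgeOne_zero, sub_zero,
    curryLeft_smul', curryLeft_wedgeOne_zero, mul_smul]

section Frame

variable {ι : Type*} [Fintype ι] [DecidableEq ι] (θ θ' : ι → (E →L[𝕜] 𝕜)) (v v' : ι → E)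
  (h1 : ∀ i j, θ i (v j) = if i = j then 1 else 0) (h2 : ∀ i j, θ' i (v' j) = if i = j then 1 else 0)
  (h3 : ∀ i j, θ i (v' j) = 0) (h4 : ∀ i j, θ' i (v j) = 0)
  (h5 : ∑ i, ((θ i).smulRight (v i) + (θ' i).smulRight (v' i)) = ContinuousLinearMap.id 𝕜 E)

include h5 in
omit [DecidableEq ι] in
/-- **Euler's identity for a split dual frame**: `∑ᵢ (θᵢ ∧ vᵢ ⌟ f + θ'ᵢ ∧ v'ᵢ ⌟ f) = (n+1) f`.
[folklore] -/
theorem sum_wedgeOne_curryLeft_two (f : E [⋀^Fin (n + 1)]→L[𝕜] F) :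
    ∑ i, (wedgeOne (θ i) (f.curryLeft (v i)) + wedgeOne (θ' i) (f.curryLeft (v' i))) =
      (n + 1) • f := by
  have key := sum_wedgeOne_curryLeft (F := F) (Sum.elim θ θ') (Sum.elim v v') ?_ f
  · rw [Fintype.sum_sum_type] at key
    simpa [Finset.sum_add_distrib] using key
  · rw [Fintype.sum_sum_type]
    simpa [Finset.sum_add_distrib] using h5

include h1 h2 in
/-- `∑ᵢ (θᵢ vⱼ · θ'ᵢ v'ⱼ) • η = η`. [folklore] -/
theorem frame_sum_mul_smul_eq (j : ι) {G : Type*} [AddCommGroup G] [Module 𝕜 G] (η : G) :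
    ∑ i, (θ i (v j) * θ' i (v' j)) • η = η := by
  simp [h1, h2, ite_smul, Finset.sum_ite_eq']

include h1 in
/-- `∑ᵢ (θᵢ vⱼ) • Xᵢ = Xⱼ`. [folklore] -/
theorem frame_sum_smul_eq (j : ι) {G : Type*} [AddCommGroup G] [Module 𝕜 G] (X : ι → G) :
    ∑ i, (θ i (v j)) • X i = X j := by
  simp [h1, ite_smul, Finset.sum_ite_eq']

include h1 h2 h3 h4 h5 in
/-- **`[L, Λ] = (k - d) Id` on `k`-forms, `k ≥ 2`** (Voisin (2002), Lemma 6.19; Huybrechts (2005),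
Prop. 1.2.26), for the CAR Lefschetz operator `L η = ∑ᵢ θᵢ ∧ θ'ᵢ ∧ η` and its adjoint
`Λ η = ∑ᵢ v'ᵢ ⌟ vᵢ ⌟ η` of a split dual frame of size `d`. [cite: Voisin2002, Lemma 6.19] -/
theorem lefschetz_comm_contract (η : E [⋀^Fin (n + 2)]→L[𝕜] F) :
    (∑ i, wedgeOne (θ i) (wedgeOne (θ' i) (∑ j, (η.curryLeft (v j)).curryLeft (v' j)))) -
      ∑ j, ((∑ i, wedgeOne (θ i) (wedgeOne (θ' i) η)).curryLeft (v j)).curryLeft (v' j) =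
      ((n + 2 : ℕ) : 𝕜) • η - (Fintype.card ι : 𝕜) • η := by
  have hN := sum_wedgeOne_curryLeft_two θ θ' v v' h5 (n := n + 1) η
  set T : ι → ι → E [⋀^Fin (n + 2)]→L[𝕜] F :=
    fun i j ↦ wedgeOne (θ i) (wedgeOne (θ' i) ((η.curryLeft (v j)).curryLeft (v' j))) with hT
  have hL : (∑ i, wedgeOne (θ i) (wedgeOne (θ' i) (∑ j, (η.curryLeft (v j)).curryLeft (v' j)))) =
      ∑ j, ∑ i, T i j := by
    rw [Finset.sum_comm]
    simp only [hT, wedgeOne_sum]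
  have hΛ : ∀ j, ((∑ i, wedgeOne (θ i) (wedgeOne (θ' i) η)).curryLeft (v j)).curryLeft (v' j) =
      η - wedgeOne (θ' j) (η.curryLeft (v' j)) - wedgeOne (θ j) (η.curryLeft (v j)) +
        ∑ i, T i j := by
    intro j
    simp only [curryLeft_sum, curryLeft_curryLeft_wedgeOne_wedgeOne _ _ _ _ (h3 _ _) (h4 _ _),
      Finset.sum_add_distrib, Finset.sum_sub_distrib, hT]
    rw [frame_sum_mul_smul_eq θ θ' v v' h1 h2, frame_sum_smul_eq θ v h1,
      frame_sum_smul_eq θ' v' h2 j (fun i ↦ wedgeOne (θ i) (η.curryLeft (v j)))]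
  rw [hL]
  simp only [hΛ, Finset.sum_add_distrib, Finset.sum_sub_distrib, Finset.sum_const, Finset.card_univ]
  rw [Finset.sum_add_distrib] at hN
  have h2' : ((n + 2 : ℕ) : 𝕜) • η = (n + 1 + 1) • η := Nat.cast_smul_eq_nsmul 𝕜 _ η
  rw [← Nat.cast_smul_eq_nsmul 𝕜 (Fintype.card ι) η, h2', ← hN]
  abel

include h1 h2 h3 h4 h5 in
/-- **`Λ L = (d - 1) Id` on `1`-forms** (the degree-`1` case of `[L, Λ] = (k - d) Id`, where
`Λ = 0`). [cite: Voisin2002, Lemma 6.19] -/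
theorem contract_lefschetz_one (η : E [⋀^Fin 1]→L[𝕜] F) :
    ∑ j, ((∑ i, wedgeOne (θ i) (wedgeOne (θ' i) η)).curryLeft (v j)).curryLeft (v' j) =
      (Fintype.card ι : 𝕜) • η - η := by
  have hN := sum_wedgeOne_curryLeft_two θ θ' v v' h5 (n := 0) η
  have hΛ : ∀ j, ((∑ i, wedgeOne (θ i) (wedgeOne (θ' i) η)).curryLeft (v j)).curryLeft (v' j) =
      η - wedgeOne (θ' j) (η.curryLeft (v' j)) - wedgeOne (θ j) (η.curryLeft (v j)) := by
    intro j
    simp only [curryLeft_sum, curryLeft_curryLeft_wedgeOne_wedgeOne_one _ _ _ _ (h3 _ _) (h4 _ _),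
      Finset.sum_sub_distrib]
    rw [frame_sum_mul_smul_eq θ θ' v v' h1 h2, frame_sum_smul_eq θ v h1,
      frame_sum_smul_eq θ' v' h2 j (fun i ↦ wedgeOne (θ i) (η.curryLeft (v j)))]
  simp only [hΛ, Finset.sum_sub_distrib, Finset.sum_const, Finset.card_univ]
  rw [Finset.sum_add_distrib] at hN
  have hN' : (∑ x, wedgeOne (θ x) (η.curryLeft (v x))) + ∑ x, wedgeOne (θ' x) (η.curryLeft (v' x)) =
      η := by simpa using hN
  rw [← Nat.cast_smul_eq_nsmul 𝕜 (Fintype.card ι) η, sub_sub, add_comm, hN']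

include h1 h2 h4 in
/-- **`Λ L = d Id` on `0`-forms** (the degree-`0` case of `[L, Λ] = (k - d) Id`).
[cite: Voisin2002, Lemma 6.19] -/
theorem contract_lefschetz_zero (η : E [⋀^Fin 0]→L[𝕜] F) :
    ∑ j, ((∑ i, wedgeOne (θ i) (wedgeOne (θ' i) η)).curryLeft (v j)).curryLeft (v' j) =
      (Fintype.card ι : 𝕜) • η := by
  have hΛ : ∀ j, ((∑ i, wedgeOne (θ i) (wedgeOne (θ' i) η)).curryLeft (v j)).curryLeft (v' j) = η := by
    intro j
    rw [curryLeft_sum, curryLeft_sum, Finset.sum_congr rfl fun i _ ↦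
      curryLeft_curryLeft_wedgeOne_wedgeOne_zero (θ i) (θ' i) (v j) (v' j) (h4 i j) η,
      frame_sum_mul_smul_eq θ θ' v v' h1 h2]
  simp only [hΛ, Finset.sum_const, Finset.card_univ]
  rw [← Nat.cast_smul_eq_nsmul 𝕜 (Fintype.card ι) η]

end Frame

/-! ### `sl₂`-strings: injectivity of `e^μ` on the weight space `-μ` -/

section Sl2

variable {R L M : Type*} [CommRing R] [LieRing L] [LieAlgebra R L] [AddCommGroup M] [Module R M]
  [LieRingModule L M] [LieModule R L M] {h e f : L}

/-- For an `sl₂`-triple `(h, e, f)`: if `y` is an `h`-eigenvector killed by `e^a`, then `e^(a+1)`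
kills `⁅f, y⁆` (from `e f = f e + h`). [folklore] -/
theorem sl2_pow_toEnd_e_succ_lie_f_eq_zero (t : IsSl2Triple h e f) :
    ∀ (a : ℕ) {y : M} {c : R}, ⁅h, y⁆ = c • y → (toEnd R L M e ^ a) y = 0 →
      (toEnd R L M e ^ (a + 1)) ⁅f, y⁆ = 0 := by
  intro a
  induction a with
  | zero =>
    intro y c _ hy
    simp only [pow_zero, Module.End.one_apply] at hy
    simp [hy]
  | succ a ih =>
    intro y c hy hey
    have hy' : ⁅h, ⁅e, y⁆⁆ = (c + 2) • ⁅e, y⁆ := by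
      rw [leibniz_lie, t.lie_h_e_smul R, hy, smul_lie, lie_smul, add_smul, add_comm]
    have hey' : (toEnd R L M e ^ a) ⁅e, y⁆ = 0 := by
      rw [← toEnd_apply_apply R, ← Module.End.mul_apply, ← pow_succ, hey]
    have key := ih hy' hey'
    have hcy : (toEnd R L M e ^ (a + 1)) (c • y) = 0 := by rw [map_smul, hey, smul_zero]
    rw [pow_succ, Module.End.mul_apply, toEnd_apply_apply, leibniz_lie e f y, t.lie_e_f, map_add,
      key, add_zero, hy, hcy]

/-- For an `sl₂`-triple: `e^(μ+p)` kills `f^p x` when `e^μ` kills the `h`-eigenvector `x`.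
[folklore] -/
theorem sl2_pow_toEnd_e_pow_toEnd_f_eq_zero (t : IsSl2Triple h e f) {x : M} {c : R}
    (hx : ⁅h, x⁆ = c • x) (μ : ℕ) (hex : (toEnd R L M e ^ μ) x = 0) (p : ℕ) :
    (toEnd R L M e ^ (μ + p)) ((toEnd R L M f ^ p) x) = 0 := by
  induction p with
  | zero => simpa using hex
  | succ p ih =>
    have hw : ⁅h, (toEnd R L M f ^ p) x⁆ = (c - 2 * p) • (toEnd R L M f ^ p) x := by
      have := t.symm.lie_h_pow_toEnd_e (m := x) (μ := -c) (by rw [neg_lie, hx, neg_smul]) p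
      rw [neg_lie, neg_eq_iff_eq_neg, ← neg_smul] at this
      rw [this]
      congr 1
      ring
    rw [pow_succ' (toEnd R L M f), Module.End.mul_apply, toEnd_apply_apply, ← add_assoc]
    exact sl2_pow_toEnd_e_succ_lie_f_eq_zero t (μ + p) hw ih

/-- **Injectivity of `e^μ` on the weight space `-μ`** for a representation of an `sl₂`-triple on
which `f` is locally nilpotent: if `⁅h, x⁆ = -μ x` (`μ ∈ ℕ`), `f^N x = 0` for some `N` and
`e^μ x = 0`, then `x = 0` (the last nonzero vector `f^p x` of the `f`-string through `x` would be
a lowest-weight vector of weight `-(μ + 2p)` killed by `e^(μ+p)`, contradicting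
`IsSl2Triple.HasPrimitiveVectorWith.pow_toEnd_f_ne_zero_of_eq_nat`). This is the representation
theory behind the hard Lefschetz isomorphism `Lⁿ⁻ᵏ : Λᵏ ≅ Λ²ⁿ⁻ᵏ` (Huybrechts (2005), Prop. 1.2.30;
Voisin (2002), Lemma 6.20). [folklore] -/
theorem sl2_eq_zero_of_pow_toEnd_e_eq_zero [CharZero R] [IsDomain R] [Module.IsTorsionFree R M]
    (t : IsSl2Triple h e f) {x : M} (μ : ℕ) (hx : ⁅h, x⁆ = -(μ : R) • x)
    (hN : ∃ N : ℕ, (toEnd R L M f ^ N) x = 0) (hex : (toEnd R L M e ^ μ) x = 0) : x = 0 := by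
  by_contra hx0
  classical
  have hex0 : ∃ p : ℕ, (toEnd R L M f ^ (p + 1)) x = 0 := by
    obtain ⟨N, hN⟩ := hN
    rcases N with - | N
    · exact absurd (by simpa using hN) hx0
    · exact ⟨N, hN⟩
  set p := Nat.find hex0 with hp
  have hp1 : (toEnd R L M f ^ (p + 1)) x = 0 := Nat.find_spec hex0
  have hp0 : (toEnd R L M f ^ p) x ≠ 0 := by
    rcases Nat.eq_zero_or_pos p with (h0 | hpos)
    · rw [h0]; simpa using hx0
    · obtain ⟨q, hq⟩ : ∃ q, p = q + 1 := ⟨p - 1, by omega⟩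
      have := Nat.find_min hex0 (show q < p by omega)
      rwa [hq]
  have hw : ⁅-h, (toEnd R L M f ^ p) x⁆ = ((μ : R) + 2 * p) • (toEnd R L M f ^ p) x :=
    t.symm.lie_h_pow_toEnd_e (m := x) (μ := (μ : R)) (by rw [neg_lie, hx, neg_smul, neg_neg]) p
  have P : t.symm.HasPrimitiveVectorWith ((toEnd R L M f ^ p) x) ((μ : R) + 2 * p) :=
    { ne_zero := hp0
      lie_h := hw
      lie_e := by
        rw [← toEnd_apply_apply R, ← Module.End.mul_apply, ← pow_succ', hp1] }
  have h1 := P.pow_toEnd_f_ne_zero_of_eq_nat (n := μ + 2 * p) (by push_cast; ring) (i := μ + p)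
    (by omega)
  exact h1 (sl2_pow_toEnd_e_pow_toEnd_f_eq_zero t hx μ hex p)

end Sl2

/-! ### The graded `sl₂`-module of forms and the pointwise hard Lefschetz injectivity -/

section Sl2Pack

variable {𝕜 : Type*} [NontriviallyNormedField 𝕜] [CharZero 𝕜] {E : Type*} [NormedAddCommGroup E]
  [NormedSpace 𝕜 E] {F : Type*} [NormedAddCommGroup F] [NormedSpace 𝕜 F]
  {ι : Type*} [Fintype ι] [DecidableEq ι] (θ θ' : ι → (E →L[𝕜] 𝕜)) (v v' : ι → E)
  (h1 : ∀ i j, θ i (v j) = if i = j then 1 else 0) (h2 : ∀ i j, θ' i (v' j) = if i = j then 1 else 0)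
  (h3 : ∀ i j, θ i (v' j) = 0) (h4 : ∀ i j, θ' i (v j) = 0)
  (h5 : ∑ i, ((θ i).smulRight (v i) + (θ' i).smulRight (v' i)) = ContinuousLinearMap.id 𝕜 E)

include h1 h2 h3 h4 h5 in
/-- **Pointwise hard Lefschetz injectivity in CAR form** (Voisin (2002), Lemma 6.20; Huybrechts
(2005), Prop. 1.2.30 (iv)): for a split dual frame `(θ, θ', v, v')` of size `d` on `E` and its
Lefschetz operator `L η = ∑ᵢ θᵢ ∧ θ'ᵢ ∧ η`, if `k + j = d` and `β₀, β₁ = L β₀, …, βⱼ = Lʲ β₀` is the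
`L`-string of a `k`-form `β₀` with `βⱼ = 0`, then `β₀ = 0` — i.e. `Lʲ : Λᵏ → Λᵏ⁺²ʲ = Λ²ᵈ⁻ᵏ` is
injective. Proof: `L`, its adjoint `Λ = ∑ᵢ v'ᵢ ⌟ vᵢ ⌟` and `H = (deg - d)` form an `sl₂`-triple on
`⨁ₘ Λᵐ` (`[L, Λ] = H` is `lefschetz_comm_contract` / `contract_lefschetz_one` /
`contract_lefschetz_zero`, Voisin Lemma 6.19), `Λ` is locally nilpotent (it lowers the degree),
and `sl2_eq_zero_of_pow_toEnd_e_eq_zero` applies to the vector `β₀` of weight `k - d = -j`.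
[cite: Voisin2002, Lemma 6.20] -/
theorem eq_zero_of_iterate_lefschetz_eq_zero {k j : ℕ} (hkj : k + j = Fintype.card ι)
    (β : (i : ℕ) → E [⋀^Fin (k + 2 * i)]→L[𝕜] F)
    (hβ : ∀ i, β (i + 1) = ∑ a, wedgeOne (θ a) (wedgeOne (θ' a) (β i)))
    (hzero : β j = 0) : β 0 = 0 := by
  classical
  -- trivial cases: no nonzero forms, or an empty frame
  rcases subsingleton_or_nontrivial F with hF | hF
  · ext w; exact Subsingleton.elim _ _
  rcases (Fintype.card ι).eq_zero_or_pos with hd0 | hdpos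
  · obtain rfl : j = 0 := by omega
    exact hzero
  -- the graded module `W = Π_m Λᵐ` and the operators `e = L`, `f = Λ`, `h = deg - d`
  set d : ℕ := Fintype.card ι with hd
  let Λk : ℕ → Type _ := fun m ↦ E [⋀^Fin m]→L[𝕜] F
  let W : Type _ := (m : ℕ) → Λk m
  -- the commutator Lie ring structure on `End W` (Mathlib's reducible non-instance)
  letI : LieRing (Module.End 𝕜 W) := LieRing.ofAssociativeRing
  let Lc : (m : ℕ) → (Λk m →ₗ[𝕜] Λk (m + 2)) := fun m ↦
    ∑ a, (((wedgeOneL (𝕜' := 𝕜) (θ a) : Λk (m + 1) →L[𝕜] Λk (m + 2)) : Λk (m + 1) →ₗ[𝕜] Λk (m + 2)) ∘ₗ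
      ((wedgeOneL (𝕜' := 𝕜) (θ' a) : Λk m →L[𝕜] Λk (m + 1)) : Λk m →ₗ[𝕜] Λk (m + 1)))
  let Λc : (m : ℕ) → (Λk (m + 2) →ₗ[𝕜] Λk m) := fun m ↦
    ∑ a, (((curryLeftL (𝕜' := 𝕜) (v' a) : Λk (m + 1) →L[𝕜] Λk m) : Λk (m + 1) →ₗ[𝕜] Λk m) ∘ₗ
      ((curryLeftL (𝕜' := 𝕜) (v a) : Λk (m + 2) →L[𝕜] Λk (m + 1)) : Λk (m + 2) →ₗ[𝕜] Λk (m + 1)))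
  have Lc_apply : ∀ (m : ℕ) (η : Λk m), Lc m η = ∑ a, wedgeOne (θ a) (wedgeOne (θ' a) η) := by
    intro m η
    simp only [Lc, LinearMap.coe_sum, Finset.sum_apply, LinearMap.comp_apply,
      ContinuousLinearMap.coe_coe]
    rfl
  have Λc_apply : ∀ (m : ℕ) (η : Λk (m + 2)), Λc m η = ∑ a, (η.curryLeft (v a)).curryLeft (v' a) := by
    intro m η
    simp only [Λc, LinearMap.coe_sum, Finset.sum_apply, LinearMap.comp_apply,
      ContinuousLinearMap.coe_coe]
    rfl
  let eC : (m : ℕ) → (W →ₗ[𝕜] Λk m) := fun m ↦ match m with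
    | 0 => 0
    | 1 => 0
    | m + 2 => Lc m ∘ₗ LinearMap.proj m
  let eOp : Module.End 𝕜 W := LinearMap.pi eC
  let fOp : Module.End 𝕜 W := LinearMap.pi fun m ↦ Λc m ∘ₗ LinearMap.proj (m + 2)
  let hOp : Module.End 𝕜 W := LinearMap.pi fun m ↦ ((m : 𝕜) - d) • LinearMap.proj m
  have e_apply2 : ∀ (w : W) (m : ℕ), eOp w (m + 2) = Lc m (w m) := fun _ _ ↦ rfl
  have e_apply0 : ∀ w : W, eOp w 0 = 0 := fun _ ↦ rfl
  have e_apply1 : ∀ w : W, eOp w 1 = 0 := fun _ ↦ rfl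
  have f_apply : ∀ (w : W) (m : ℕ), fOp w m = Λc m (w (m + 2)) := fun _ _ ↦ rfl
  have h_apply : ∀ (w : W) (m : ℕ), hOp w m = ((m : 𝕜) - d) • w m := fun _ _ ↦ rfl
  -- the `sl₂` relations
  have t : IsSl2Triple hOp eOp fOp := by
    refine ⟨?_, ?_, ?_, ?_⟩
    · -- `h ≠ 0`: it acts by `-d ≠ 0` on the nonzero constant `0`-forms
      intro H
      obtain ⟨x₀, hx₀⟩ := exists_ne (0 : F)
      let c : Λk 0 := ContinuousAlternatingMap.constOfIsEmpty 𝕜 E (Fin 0) x₀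
      have hc : c ≠ 0 := by
        intro hc
        have h0 := DFunLike.congr_fun hc Fin.elim0
        exact hx₀ h0
      have key : hOp (Pi.single 0 c) 0 = (0 : Module.End 𝕜 W) (Pi.single 0 c) 0 := by rw [H]
      rw [h_apply, Pi.single_eq_same, LinearMap.zero_apply] at key
      have hW0 : (0 : W) 0 = 0 := rfl
      rw [hW0, Nat.cast_zero, zero_sub, neg_smul, neg_eq_zero, smul_eq_zero] at key
      have key' := key
      rcases key' with h0 | h0
      · exact absurd h0 (by exact_mod_cast hdpos.ne')
      · exact hc h0
    · -- `[e, f] = h`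
      refine LinearMap.ext fun w ↦ funext fun m ↦ ?_
      rw [LieRing.of_associative_ring_bracket, LinearMap.sub_apply, Pi.sub_apply,
        Module.End.mul_apply, Module.End.mul_apply, h_apply]
      match m with
      | 0 =>
        rw [e_apply0, f_apply, e_apply2, Λc_apply, Lc_apply,
          contract_lefschetz_zero θ θ' v v' h1 h2 h4, zero_sub, Nat.cast_zero, zero_sub, neg_smul]
      | 1 =>
        rw [e_apply1, f_apply, e_apply2, Λc_apply, Lc_apply,
          contract_lefschetz_one θ θ' v v' h1 h2 h3 h4 h5, zero_sub, Nat.cast_one, sub_smul,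
          one_smul, neg_sub]
      | m + 2 =>
        rw [e_apply2, f_apply, f_apply, e_apply2, Λc_apply, Lc_apply, Λc_apply, Lc_apply,
          lefschetz_comm_contract θ θ' v v' h1 h2 h3 h4 h5, ← sub_smul, Nat.cast_add, Nat.cast_two]
    · -- `[h, e] = 2e`
      refine LinearMap.ext fun w ↦ funext fun m ↦ ?_
      rw [LieRing.of_associative_ring_bracket, LinearMap.sub_apply, Pi.sub_apply,
        Module.End.mul_apply, Module.End.mul_apply, two_smul, LinearMap.add_apply, Pi.add_apply]
      match m with
      | 0 => rw [e_apply0, h_apply, e_apply0, smul_zero, sub_zero, add_zero]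
      | 1 => rw [e_apply1, h_apply, e_apply1, smul_zero, sub_zero, add_zero]
      | m + 2 =>
        rw [h_apply, e_apply2, e_apply2, h_apply, map_smul, ← sub_smul, Nat.cast_add, Nat.cast_two]
        rw [show ((m : 𝕜) + 2 - d - ((m : 𝕜) - d)) = 2 by ring, two_smul]
    · -- `[h, f] = -2f`
      refine LinearMap.ext fun w ↦ funext fun m ↦ ?_
      rw [LieRing.of_associative_ring_bracket, LinearMap.sub_apply, Pi.sub_apply,
        Module.End.mul_apply, Module.End.mul_apply, two_smul, LinearMap.neg_apply,
        LinearMap.add_apply, Pi.neg_apply, Pi.add_apply, h_apply, f_apply, f_apply, h_apply,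
        map_smul, ← sub_smul, Nat.cast_add, Nat.cast_two,
        show ((m : 𝕜) - d - ((m : 𝕜) + 2 - d)) = -2 by ring, neg_smul, two_smul]
  -- the vector `x = β₀` in degree `k`, of weight `k - d = -j`
  let x : W := Pi.single k (β 0)
  have hx : ⁅hOp, x⁆ = -(j : 𝕜) • x := by
    rw [Module.End.lie_apply]
    funext m
    rw [h_apply, Pi.smul_apply]
    by_cases hm : m = k
    · subst hm
      congr 1
      have : (d : 𝕜) = m + j := by exact_mod_cast hkj.symm
      rw [this]; ring
    · simp [x, Pi.single_eq_of_ne hm]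
  -- `e` on one-component vectors
  have e_single : ∀ (m : ℕ) (η : Λk m), eOp (Pi.single m η) = Pi.single (m + 2) (Lc m η) := by
    intro m η
    funext m'
    match m' with
    | 0 => rw [e_apply0, Pi.single_eq_of_ne (by omega)]
    | 1 => rw [e_apply1, Pi.single_eq_of_ne (by omega)]
    | m' + 2 =>
      rw [e_apply2]
      by_cases hm : m' = m
      · subst hm; rw [Pi.single_eq_same, Pi.single_eq_same]
      · rw [Pi.single_eq_of_ne hm, Pi.single_eq_of_ne (by omega), LinearMap.map_zero]
  have he_pow : ∀ i, (eOp ^ i) x = Pi.single (k + 2 * i) (β i) := by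
    intro i
    induction i with
    | zero => rfl
    | succ i ih =>
      rw [pow_succ', Module.End.mul_apply, ih, e_single, Lc_apply, ← hβ i]
      rfl
  have he_zero : (eOp ^ j) x = 0 := by rw [he_pow, hzero, Pi.single_zero]
  -- `f` is locally nilpotent on `x` (it lowers the degree by `2`)
  have hf_deg : ∀ (N m : ℕ), (fOp ^ N) x m ≠ 0 → m + 2 * N = k := by
    intro N
    induction N with
    | zero =>
      intro m hm
      by_contra hmk
      exact hm (by rw [pow_zero, Module.End.one_apply]; exact Pi.single_eq_of_ne (by omega) _)
    | succ N ih =>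
      intro m hm
      rw [pow_succ', Module.End.mul_apply, f_apply] at hm
      have hm' : (fOp ^ N) x (m + 2) ≠ 0 := fun h0 ↦ hm (by rw [h0, LinearMap.map_zero])
      have := ih (m + 2) hm'
      omega
  have hf_nil : (fOp ^ (k + 1)) x = 0 := by
    funext m
    by_contra hm
    have := hf_deg (k + 1) m hm
    omega
  -- conclude by the `sl₂`-string lemma
  have htoE : toEnd 𝕜 (Module.End 𝕜 W) W eOp = eOp := by ext w; rfl
  have htoF : toEnd 𝕜 (Module.End 𝕜 W) W fOp = fOp := by ext w; rfl
  have hx0 : x = 0 :=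
    sl2_eq_zero_of_pow_toEnd_e_eq_zero t j hx ⟨k + 1, by rw [htoF, hf_nil]⟩ (by rw [htoE, he_zero])
  have hk : x k = 0 := by rw [hx0]; rfl
  simpa [x] using hk

end Sl2Pack

end Literature.LinearAlgebra.Alternating
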